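import Literature.Analysis.FluidPDE.LocalLerayPressureDecompositionHolds
import Literature.Analysis.FluidPDE.LocalLeraySlabCubicIntegrability
import Literature.Analysis.FluidPDE.LocalLerayPressureRenormalisation
import HarnessLib

/-!
# Jia–Šverák 2014, towards Thm. 3.2: the local pressure expansion and its gauge for local Leray
  solutions **on a slab** `(0, T) × ℝ³`

Analysis/FluidPDE proofs file (theorems only, no new definitions, no new named facts), part of
the proof of the named fact `Literature.Analysis.FluidPDE.jia_sverak_2014_theorem_3_2`
(`JiaSverak2014LocalRegularity.lean`; H. Jia, V. Šverák, Invent. Math. 196 (2014) =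
arXiv:1204.0529, §3 Thm. 3.2). Jia–Šverák's proofs of Lemma 3.1 and Thm. 3.1 (arXiv pp. 7–8)
use the local pressure expansion of a Leray solution, formula (3.3) of §3 (remark after Def. 3.1:
"for some constant `c_{x₀,R}(t)`"), i.e. Kang–Miura–Tsai 2021, **Lemma 3.4**:
`π = π_loc + π_far + c_{x₀,r}(t)` on `B_r(x₀) × (0,T)` with `c_{x₀,r} ∈ L^{3/2}(0,T)`. The tree
PROVES this for Jia–Šverák's global-in-time class (`kangMiuraTsai_pressure_decomposition_holds`,
`IsLocalLeraySolution.exists_gauge`, `LocalLerayPressureDecompositionHolds.lean`) from slab tools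
(`IsLocalLeraySolutionOn.ae_slice_pgIdentity`, `slice_pressure_representation`). Since the fact
`jia_sverak_2014_theorem_3_2` is stated over the finite-slab class `IsLocalLeraySolutionOn T`
(Lemarié-Rieusset 2016, Def. 14.1), this file records the expansion for the slab class itself,
with the tree's proofs (verbatim up to the class projections):

* `IsLocalLeraySolutionOn.aestronglyMeasurable_box`, `…_pressure_box`,
  `IsLocalLeraySolutionOn.ae_lintegral_cube_ball_lt_top` — bookkeeping (measurability on boxes,
  `v(t) ∈ L³(B)` for a.e. `t` from the slab cubic integrability
  `IsLocalLeraySolutionOn.lintegral_cube_box_lt_top`);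
* `IsLocalLeraySolutionOn.ae_exists_slice_representation` — Lemma 3.4 on a.e. slice;
* `IsLocalLeraySolutionOn.exists_gauge` — the ball-mean gauge is in `L^{3/2}(0,T)`;
* `IsLocalLeraySolutionOn.exists_pressure_decomposition` — Lemma 3.4 a.e. on `(0,T) × B_r(x₀)`;
* `IsLocalLeraySolutionOn.exists_measurable_gauge` — a measurable gauge `c` at radius `3` with
  `π - c = π_loc + π_far` a.e. on `(0,T) × B_3(y)` and `∫∫_{(0,T)×B_R} |π - c|^{3/2} < ∞` for all
  `R` (the form consumed by the a priori estimate, cf. `JiaSverak2013.exists_measurable_gauge`).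

## Mathlib / tree search

Tree: `IsLocalLeraySolution.exists_gauge`, `IsLocalLeraySolution.ae_exists_slice_representation`,
`kangMiuraTsai_pressure_decomposition_holds`, `JiaSverak2013.exists_measurable_gauge` (global class);
slab tools `IsLocalLeraySolutionOn.ae_slice_pgIdentity`, `.ae_aestronglyMeasurable_slice'`,
`.aestronglyMeasurable_localPressureNear/Far`, `.aestronglyMeasurable_pressure`,
`.lintegral_cube_box_lt_top`, `slice_pressure_representation`,
`exists_lintegral_localPressureNear_le`, `stein1970_normalisedPressure_ae_Lp_bound_holds`,
`enorm_localPressureFar_le`, `exists_farField_tail_le`, `exists_abs_pressureKernel_sub_le`,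
`lintegral_lintegral_enorm_rpow_box`, `eLpNorm_threeHalves_lt_top_of_lintegral`,
`enorm_sub_rpow_threeHalves_le`, `lintegral_prod_of_time_only`. Mathlib:
`Measure.ae_prod_mem_iff_ae_ae_mem`, `AEMeasurable.mk`.

## References

* H. Jia, V. Šverák, Invent. Math. 196 (2014) = arXiv:1204.0529, §3 remark after Def. 3.1 and
  formula (3.3). Bib key `JiaSverak2014`.
* K. Kang, H. Miura, T.-P. Tsai, IMRN 2021 = arXiv:1812.10509, Lemma 3.4 (p. 8), §8 (pp. 17–18).
  Bib key `KangMiuraTsai2020`.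
* P. G. Lemarié-Rieusset, *The Navier–Stokes Problem in the 21st Century* (2016), Def. 14.1.
  Bib key `LemarieRieusset2016`.
-/

noncomputable section

open MeasureTheory TopologicalSpace Set Function Filter Metric
open _root_.Topology
open scoped ENNReal NNReal RealInnerProductSpace Laplacian

namespace Literature.Analysis.FluidPDE

-- nested operator types `ℝ³ →L[ℝ] ℝ³ →L[ℝ] ℝ³ →L[ℝ] ℝ`
set_option maxSynthPendingDepth 3

namespace IsLocalLeraySolutionOn

variable {T ν : ℝ} {v₀ : EuclideanSpace ℝ (Fin 3) → EuclideanSpace ℝ (Fin 3)}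
  {v : ℝ → EuclideanSpace ℝ (Fin 3) → EuclideanSpace ℝ (Fin 3)}
  {π : ℝ → EuclideanSpace ℝ (Fin 3) → ℝ}

/-! ## Bookkeeping on boxes -/

/-- A local Leray solution on a slab is a.e.-strongly measurable on the boxes `(0, T) × s`.
[folklore] -/
theorem aestronglyMeasurable_box (hv : IsLocalLeraySolutionOn T ν v₀ v π)
    (s : Set (EuclideanSpace ℝ (Fin 3))) :
    AEStronglyMeasurable (uncurry v)
      ((volume.restrict (Ioo (0 : ℝ) T)).prod (volume.restrict s)) := by
  rw [Measure.prod_restrict, ← Measure.volume_eq_prod]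
  exact hv.aestronglyMeasurable.mono_measure
    (Measure.restrict_mono (Set.prod_mono Subset.rfl (subset_univ _)) le_rfl)

/-- The pressure of a local Leray solution on a slab is a.e.-strongly measurable on the boxes
`(0, T) × s`. [folklore] -/
theorem aestronglyMeasurable_pressure_box (hv : IsLocalLeraySolutionOn T ν v₀ v π)
    (s : Set (EuclideanSpace ℝ (Fin 3))) :
    AEStronglyMeasurable (uncurry π)
      ((volume.restrict (Ioo (0 : ℝ) T)).prod (volume.restrict s)) := by
  rw [Measure.prod_restrict, ← Measure.volume_eq_prod]
  exact hv.aestronglyMeasurable_pressure.mono_measure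
    (Measure.restrict_mono (Set.prod_mono Subset.rfl (subset_univ _)) le_rfl)

/-- For a.e. `t ∈ (0,T)`, the slice `v(t)` of a local Leray solution on the slab is in `L³` of
every ball (Tonelli on `(0,T) × B_ρ(x₀)`, where `∫∫ |v|³ < ∞` by the slab cubic integrability
`lintegral_cube_box_lt_top`). [folklore] -/
theorem ae_lintegral_cube_ball_lt_top (hv : IsLocalLeraySolutionOn T ν v₀ v π)
    (x₀ : EuclideanSpace ℝ (Fin 3)) (ρ : ℝ) :
    ∀ᵐ t ∂(volume.restrict (Ioo (0 : ℝ) T)), ∫⁻ y in ball x₀ ρ, ‖v t y‖ₑ ^ (3 : ℕ) < ⊤ := by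
  set μt : Measure ℝ := volume.restrict (Ioo (0 : ℝ) T) with hμt
  set μK : Measure (EuclideanSpace ℝ (Fin 3)) := volume.restrict (ball x₀ ρ) with hμK
  have hvmK : AEStronglyMeasurable (uncurry v) (μt.prod μK) := hv.aestronglyMeasurable_box _
  have hG : AEMeasurable (fun z : ℝ × EuclideanSpace ℝ (Fin 3) => ‖v z.1 z.2‖ₑ ^ (3 : ℕ)) (μt.prod μK) :=
    hvmK.enorm.pow_const _
  have hfin : ∫⁻ t, ∫⁻ x, ‖v t x‖ₑ ^ (3 : ℕ) ∂μK ∂μt < ⊤ := by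
    rw [hμt, hμK, lintegral_lintegral_enorm_pow_box hvmK 3]
    exact hv.lintegral_cube_box_lt_top x₀ ρ
  exact ae_lt_top' hG.lintegral_prod_right' hfin.ne

/-! ## The expansion on a.e. slice -/

/-- **The local pressure expansion on almost every time slice, slab class** (Kang–Miura–Tsai
2021, Lemma 3.4, slice by slice; Jia–Šverák 2014, (3.3)): for a local Leray solution `(v, π)` on
`(0,T) × ℝ³`, a centre `x₀` and a radius `r > 0`, for a.e. `t ∈ (0,T)` there is a constant `κ(t)`
with `π(t) = π_loc(t) + π_far(t) + κ(t)` a.e. on `B_r(x₀)` (the Liouville identities on a.e.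
slice, `ae_slice_pgIdentity`, fed into `slice_pressure_representation`).
[cite: KangMiuraTsai2020, Lemma 3.4 (pressure decomposition), arXiv:1812.10509 p. 8] [cite: JiaSverak2014, §3 (3.3)] -/
theorem ae_exists_slice_representation (hv : IsLocalLeraySolutionOn T ν v₀ v π)
    (x₀ : EuclideanSpace ℝ (Fin 3)) {r : ℝ} (hr : 0 < r) :
    ∀ᵐ t ∂(volume.restrict (Ioo (0 : ℝ) T)), ∃ κ : ℝ,
      ∀ᵐ x ∂(volume.restrict (ball x₀ r)),
        π t x = localPressureNear x₀ r v t x + localPressureFar x₀ r v t x + κ := by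
  obtain ⟨A, hA⟩ := hv.ae_slice_pgIdentity
  filter_upwards [hA, hv.ae_lintegral_cube_ball_lt_top x₀ (2 * r)] with t ht hct
  obtain ⟨hmt, -, hπt, hAt, -, hid⟩ := ht
  obtain ⟨κ, -, hrep⟩ := slice_pressure_representation (A := (A : ℝ≥0∞)) hmt ENNReal.coe_ne_top
    hAt hπt hid x₀ hr hct.ne
  exact ⟨κ, hrep⟩

/-! ## The gauge -/

/-- **The gauge of the local pressure expansion and its integrability, slab class**
(Kang–Miura–Tsai 2021, Lemma 3.4: "for some function `c_{x₀,r}(t) ∈ L^{3/2}(0,T)`"). For a local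
Leray solution on `(0,T) × ℝ³`, `x₀`, `r > 0`, the ball mean
`c(t) = ⨍_{B_r(x₀)} (π - π_loc - π_far)(t, x) dx` is in `L^{3/2}(0,T)` and
`π(t) = π_loc(t) + π_far(t) + c(t)` a.e. on `B_r(x₀)` for a.e. `t ∈ (0,T)`. The proof is the
tree's proof of `IsLocalLeraySolution.exists_gauge` with the slab projections (uniformly local
energy at radius `r` on `(0,T)`, `π ∈ L^{3/2}` and `v ∈ L³` on the boxes up to `t = 0`).
[cite: KangMiuraTsai2020, Lemma 3.4 (the gauge c_{x₀,r} ∈ L^{3/2}(0,T)) with §8 (bounds for p_loc, p_far), arXiv:1812.10509 pp. 8, 18] -/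
theorem exists_gauge (hv : IsLocalLeraySolutionOn T ν v₀ v π)
    (x₀ : EuclideanSpace ℝ (Fin 3)) {r : ℝ} (hr : 0 < r) :
    ∃ c : ℝ → ℝ, MemLp c (3 / 2 : ℝ≥0∞) (volume.restrict (Ioo 0 T)) ∧
      ∀ᵐ t ∂(volume.restrict (Ioo (0 : ℝ) T)), ∀ᵐ x ∂(volume.restrict (ball x₀ r)),
        π t x = localPressureNear x₀ r v t x + localPressureFar x₀ r v t x + c t := by
  set B : Set (EuclideanSpace ℝ (Fin 3)) := ball x₀ r with hB
  set S : Set (EuclideanSpace ℝ (Fin 3)) := ball x₀ (2 * r) with hS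
  set μt : Measure ℝ := volume.restrict (Ioo (0 : ℝ) T) with hμt
  set μB : Measure (EuclideanSpace ℝ (Fin 3)) := volume.restrict B with hμB
  set N := localPressureNear x₀ r v with hN
  set Fa := localPressureFar x₀ r v with hFa
  have hB0 : volume B ≠ 0 := (measure_ball_pos volume x₀ hr).ne'
  have hBt : volume B ≠ ⊤ := measure_ball_lt_top.ne
  -- joint measurability on `(0,T) × B`
  have hπm : AEStronglyMeasurable (uncurry π) (μt.prod μB) := hv.aestronglyMeasurable_pressure_box B
  have hNm : AEStronglyMeasurable (fun z : ℝ × EuclideanSpace ℝ (Fin 3) => N z.1 z.2) (μt.prod μB) :=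
    (hv.aestronglyMeasurable_localPressureNear x₀ r).mono_measure
      (Measure.prod_mono le_rfl Measure.restrict_le_self)
  have hFam : AEStronglyMeasurable (fun z : ℝ × EuclideanSpace ℝ (Fin 3) => Fa z.1 z.2) (μt.prod μB) :=
    (hv.aestronglyMeasurable_localPressureFar x₀ r).mono_measure
      (Measure.prod_mono le_rfl Measure.restrict_le_self)
  set D : ℝ → EuclideanSpace ℝ (Fin 3) → ℝ := fun t x => π t x - N t x - Fa t x with hD
  have hDm : AEStronglyMeasurable (uncurry D) (μt.prod μB) := (hπm.sub hNm).sub hFam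
  -- the gauge
  set c : ℝ → ℝ := fun t => ⨍ x in B, D t x with hc
  have hcm : AEStronglyMeasurable c μt := by
    have h1 : AEStronglyMeasurable (fun t => ∫ x in B, D t x) μt := hDm.integral_prod_right'
    have h2 : c = fun t => ((volume : Measure (EuclideanSpace ℝ (Fin 3))).real B)⁻¹ • ∫ x in B, D t x := by
      funext t
      rw [hc]
      exact setAverage_eq _ _ _
    rw [h2]
    exact h1.const_smul (((volume : Measure (EuclideanSpace ℝ (Fin 3))).real B)⁻¹)
  -- the identity on a.e. slice, and `c t = κ t`
  have hslice : ∀ᵐ t ∂μt, ∀ᵐ x ∂μB, π t x = N t x + Fa t x + c t := by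
    filter_upwards [hv.ae_exists_slice_representation x₀ hr] with t ht
    obtain ⟨κ, hκ⟩ := ht
    have hDκ : (fun x => D t x) =ᵐ[μB] fun _ => κ := by
      filter_upwards [hκ] with x hx
      simp only [hD, hx]
      ring
    have hct : c t = κ := by
      show ⨍ x, D t x ∂μB = κ
      rw [average_congr hDκ, hμB]
      exact setAverage_const hB0 hBt _
    filter_upwards [hκ] with x hx
    rw [hct, hx]
  refine ⟨c, ⟨hcm, ?_⟩, hslice⟩
  -- ## the `L^{3/2}` bound on the gauge
  obtain ⟨Cn, hCn0, hCntop, hnear⟩ :=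
    exists_lintegral_localPressureNear_le stein1970_normalisedPressure_ae_Lp_bound_holds
  obtain ⟨CK, hCK0, hCK⟩ := exists_abs_pressureKernel_sub_le
  obtain ⟨Kf, hKftop, hKf⟩ := exists_farField_tail_le hr
  obtain ⟨Ar, hAr⟩ := hv.uniformLocalEnergy r hr
  -- the far-field tail is uniformly bounded for a.e. `t`
  set TB : ℝ≥0∞ := Kf * ENNReal.ofReal ((2 * r - r)⁻¹) * Ar with hTB
  have hTBtop : TB ≠ ⊤ :=
    ENNReal.mul_ne_top (ENNReal.mul_ne_top hKftop ENNReal.ofReal_ne_top) ENNReal.coe_ne_top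
  have hTail_le : ∀ᵐ t ∂μt,
      ∫⁻ y in Sᶜ, ‖v t y‖ₑ ^ (2 : ℕ) * RieszKernel.powKer 4 (y - x₀) ≤ TB := by
    filter_upwards [hAr, hv.ae_aestronglyMeasurable_slice'] with t hAt hmt
    have h := hKf (fun y => ‖v t y‖ₑ ^ (2 : ℕ)) (hmt.enorm.pow_const _) Ar hAt x₀ (2 * r) le_rfl
    simp_rw [powKer_four_eq_ofReal_inv]
    exact h
  set FB : ℝ≥0∞ := ENNReal.ofReal (CK * r) * TB with hFB
  have hFBtop : FB ≠ ⊤ := ENNReal.mul_ne_top ENNReal.ofReal_ne_top hTBtop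
  -- slice measurability of the pressure
  have hπslice : ∀ᵐ t ∂μt, AEStronglyMeasurable (π t) μB := by
    filter_upwards [hπm.prodMk_left] with t ht
    exact ht
  -- abbreviations for the slice functionals
  set P : ℝ → ℝ≥0∞ := fun t => ∫⁻ x in B, ‖π t x‖ₑ ^ (3 / 2 : ℝ) with hP
  set V3 : ℝ → ℝ≥0∞ := fun t => ∫⁻ y in S, ‖v t y‖ₑ ^ (3 : ℕ) with hV3
  -- the bound on a.e. slice
  have hpt : ∀ᵐ t ∂μt, ‖c t‖ₑ ^ (3 / 2 : ℝ) ≤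
      (volume B)⁻¹ * (2 * (P t + Cn * V3 t)) + 2 * FB ^ (3 / 2 : ℝ) := by
    filter_upwards [hslice, hTail_le, hπslice, hv.ae_aestronglyMeasurable_slice',
      hv.ae_lintegral_cube_ball_lt_top x₀ (2 * r)] with t hid hTt hπt hvt hct
    -- `‖c t‖^{3/2} |B| = ∫_B |π - N - Fa|^{3/2}`
    have h1 : ‖c t‖ₑ ^ (3 / 2 : ℝ) * volume B =
        ∫⁻ x in B, ‖π t x - N t x - Fa t x‖ₑ ^ (3 / 2 : ℝ) := by
      rw [← setLIntegral_const]
      refine lintegral_congr_ae ?_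
      filter_upwards [hid] with x hx
      rw [hx]
      congr 2
      ring
    -- pointwise bound on `B`
    have hfar : ∀ x ∈ B, ‖Fa t x‖ₑ ≤ FB := fun x hx =>
      (enorm_localPressureFar_le hCK0 hCK x₀ hr v t hx).trans (mul_le_mul' le_rfl hTt)
    have h2 : ∀ x ∈ B, ‖π t x - N t x - Fa t x‖ₑ ^ (3 / 2 : ℝ) ≤
        2 * (‖π t x‖ₑ ^ (3 / 2 : ℝ) + ‖N t x‖ₑ ^ (3 / 2 : ℝ) + FB ^ (3 / 2 : ℝ)) := by
      intro x hx
      calc ‖π t x - N t x - Fa t x‖ₑ ^ (3 / 2 : ℝ)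
          ≤ (‖π t x‖ₑ + ‖N t x‖ₑ + ‖Fa t x‖ₑ) ^ (3 / 2 : ℝ) := by
            refine ENNReal.rpow_le_rpow ?_ (by norm_num)
            calc ‖π t x - N t x - Fa t x‖ₑ ≤ ‖π t x - N t x‖ₑ + ‖Fa t x‖ₑ := enorm_sub_le
              _ ≤ ‖π t x‖ₑ + ‖N t x‖ₑ + ‖Fa t x‖ₑ := add_le_add enorm_sub_le le_rfl
        _ ≤ 2 * (‖π t x‖ₑ ^ (3 / 2 : ℝ) + ‖N t x‖ₑ ^ (3 / 2 : ℝ) + ‖Fa t x‖ₑ ^ (3 / 2 : ℝ)) :=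
            add_add_rpow_threeHalves_le _ _ _
        _ ≤ 2 * (‖π t x‖ₑ ^ (3 / 2 : ℝ) + ‖N t x‖ₑ ^ (3 / 2 : ℝ) + FB ^ (3 / 2 : ℝ)) := by
            gcongr
            exact hfar x hx
    -- integrate over `B`
    have hNB : ∫⁻ x in B, ‖N t x‖ₑ ^ (3 / 2 : ℝ) ≤ Cn * V3 t :=
      (lintegral_mono' Measure.restrict_le_self le_rfl).trans (hnear x₀ r v t hvt hct.ne)
    have h3 : ∫⁻ x in B, ‖π t x - N t x - Fa t x‖ₑ ^ (3 / 2 : ℝ) ≤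
        2 * (P t + Cn * V3 t) + 2 * FB ^ (3 / 2 : ℝ) * volume B := by
      calc ∫⁻ x in B, ‖π t x - N t x - Fa t x‖ₑ ^ (3 / 2 : ℝ)
          ≤ ∫⁻ x in B, 2 * (‖π t x‖ₑ ^ (3 / 2 : ℝ) + ‖N t x‖ₑ ^ (3 / 2 : ℝ) + FB ^ (3 / 2 : ℝ)) :=
            setLIntegral_mono' measurableSet_ball h2
        _ = 2 * (P t + (∫⁻ x in B, ‖N t x‖ₑ ^ (3 / 2 : ℝ)) + FB ^ (3 / 2 : ℝ) * volume B) := by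
            rw [lintegral_const_mul' _ _ ENNReal.ofNat_ne_top, lintegral_add_right' _ aemeasurable_const,
              lintegral_add_left' (hπt.enorm.pow_const _), setLIntegral_const]
        _ ≤ 2 * (P t + Cn * V3 t + FB ^ (3 / 2 : ℝ) * volume B) := by gcongr
        _ = 2 * (P t + Cn * V3 t) + 2 * FB ^ (3 / 2 : ℝ) * volume B := by ring
    -- divide by `|B|`
    have h4 : ‖c t‖ₑ ^ (3 / 2 : ℝ) * volume B ≤ 2 * (P t + Cn * V3 t) + 2 * FB ^ (3 / 2 : ℝ) * volume B := by
      rw [h1]; exact h3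
    calc ‖c t‖ₑ ^ (3 / 2 : ℝ) = ‖c t‖ₑ ^ (3 / 2 : ℝ) * volume B / volume B := by
          rw [ENNReal.mul_div_cancel_right hB0 hBt]
      _ ≤ (2 * (P t + Cn * V3 t) + 2 * FB ^ (3 / 2 : ℝ) * volume B) / volume B :=
          ENNReal.div_le_div_right h4 _
      _ = (volume B)⁻¹ * (2 * (P t + Cn * V3 t)) + 2 * FB ^ (3 / 2 : ℝ) := by
          rw [ENNReal.add_div, ENNReal.mul_div_cancel_right hB0 hBt, div_eq_mul_inv, mul_comm]
  -- integrate in time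
  have hvS : AEStronglyMeasurable (uncurry v) (μt.prod (volume.restrict S)) :=
    hv.aestronglyMeasurable_box S
  have hPm : AEMeasurable P μt := (hπm.enorm.pow_const _).lintegral_prod_right'
  have hV3m : AEMeasurable V3 μt := (hvS.enorm.pow_const _).lintegral_prod_right'
  have hPfin : ∫⁻ t, P t ∂μt ≠ ⊤ := by
    rw [hP, hμt, lintegral_lintegral_enorm_rpow_box hπm (3 / 2)]
    refine (lt_of_le_of_lt (lintegral_mono_set (Set.prod_mono Subset.rfl ball_subset_closedBall))
      (hv.pressure (closedBall x₀ r) (isCompact_closedBall _ _))).ne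
  have hV3fin : ∫⁻ t, V3 t ∂μt ≠ ⊤ := by
    rw [hV3, hμt, lintegral_lintegral_enorm_pow_box hvS 3]
    exact (hv.lintegral_cube_box_lt_top x₀ (2 * r)).ne
  have hXm : AEMeasurable (fun t => (volume B)⁻¹ * (2 * (P t + Cn * V3 t))) μt :=
    ((hPm.add (hV3m.const_mul _)).const_mul _).const_mul _
  have hX : ∫⁻ t, (volume B)⁻¹ * (2 * (P t + Cn * V3 t)) ∂μt =
      (volume B)⁻¹ * (2 * ((∫⁻ t, P t ∂μt) + Cn * ∫⁻ t, V3 t ∂μt)) := by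
    rw [lintegral_const_mul' _ _ (ENNReal.inv_ne_top.2 hB0), lintegral_const_mul' _ _ ENNReal.ofNat_ne_top,
      lintegral_add_left' hPm, lintegral_const_mul' _ _ hCntop]
  have hXfin : ∫⁻ t, (volume B)⁻¹ * (2 * (P t + Cn * V3 t)) ∂μt ≠ ⊤ := by
    rw [hX]
    exact ENNReal.mul_ne_top (ENNReal.inv_ne_top.2 hB0) (ENNReal.mul_ne_top ENNReal.ofNat_ne_top
      (ENNReal.add_ne_top.2 ⟨hPfin, ENNReal.mul_ne_top hCntop hV3fin⟩))
  have hμt_fin : μt univ ≠ ⊤ := by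
    rw [hμt, Measure.restrict_apply_univ]
    exact measure_Ioo_lt_top.ne
  have hfin : ∫⁻ t, ‖c t‖ₑ ^ (3 / 2 : ℝ) ∂μt ≠ ⊤ := by
    refine ne_top_of_le_ne_top ?_ (lintegral_mono_ae hpt)
    rw [lintegral_add_right' _ aemeasurable_const, lintegral_const]
    exact ENNReal.add_ne_top.2 ⟨hXfin, ENNReal.mul_ne_top (ENNReal.mul_ne_top ENNReal.ofNat_ne_top
      (ENNReal.rpow_ne_top_of_nonneg (by norm_num) hFBtop)) hμt_fin⟩
  exact eLpNorm_threeHalves_lt_top_of_lintegral hfin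

/-! ## The expansion a.e. on the box -/

/-- **The local pressure expansion of a local Leray solution on a slab** (Kang–Miura–Tsai 2021,
**Lemma 3.4**, for Lemarié-Rieusset's class of Def. 14.1 on `(0,T) × ℝ³`; = Jia–Šverák 2014,
(3.3)): for every `x₀`, `r > 0` there is `c ∈ L^{3/2}(0,T)` with
`π = π_loc + π_far + c(t)` a.e. on `(0,T) × B_r(x₀)` (the slice-wise identity of `exists_gauge`
is an identity a.e. on the box since all terms are jointly measurable; the tree's proof of
`kangMiuraTsai_pressure_decomposition_holds`).
[cite: KangMiuraTsai2020, Lemma 3.4 (pressure decomposition), arXiv:1812.10509 p. 8; proof §8 pp. 17–18] [cite: JiaSverak2014, §3 (3.3)] -/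
theorem exists_pressure_decomposition (hv : IsLocalLeraySolutionOn T ν v₀ v π)
    (x₀ : EuclideanSpace ℝ (Fin 3)) {r : ℝ} (hr : 0 < r) :
    ∃ c : ℝ → ℝ, MemLp c (3 / 2 : ℝ≥0∞) (volume.restrict (Ioo 0 T)) ∧
      ∀ᵐ z ∂(volume.restrict (Ioo 0 T ×ˢ ball x₀ r)),
        π z.1 z.2 = localPressureNear x₀ r v z.1 z.2 + localPressureFar x₀ r v z.1 z.2 + c z.1 := by
  set B : Set (EuclideanSpace ℝ (Fin 3)) := ball x₀ r with hB
  set μt : Measure ℝ := volume.restrict (Ioo (0 : ℝ) T) with hμt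
  set μB : Measure (EuclideanSpace ℝ (Fin 3)) := volume.restrict B with hμB
  have hprod : μt.prod μB = volume.restrict (Ioo (0 : ℝ) T ×ˢ B) := by
    rw [hμt, hμB, Measure.prod_restrict, ← Measure.volume_eq_prod]
  obtain ⟨c, hc, hslice⟩ := hv.exists_gauge x₀ hr
  refine ⟨c, hc, ?_⟩
  -- joint measurability of all terms on `(0,T) × B`
  have hπm : AEStronglyMeasurable (uncurry π) (μt.prod μB) := hv.aestronglyMeasurable_pressure_box B
  have hNm : AEStronglyMeasurable
      (fun z : ℝ × EuclideanSpace ℝ (Fin 3) => localPressureNear x₀ r v z.1 z.2) (μt.prod μB) :=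
    (hv.aestronglyMeasurable_localPressureNear x₀ r).mono_measure
      (Measure.prod_mono le_rfl Measure.restrict_le_self)
  have hFam : AEStronglyMeasurable
      (fun z : ℝ × EuclideanSpace ℝ (Fin 3) => localPressureFar x₀ r v z.1 z.2) (μt.prod μB) :=
    (hv.aestronglyMeasurable_localPressureFar x₀ r).mono_measure
      (Measure.prod_mono le_rfl Measure.restrict_le_self)
  have hcm : AEStronglyMeasurable (fun z : ℝ × EuclideanSpace ℝ (Fin 3) => c z.1) (μt.prod μB) :=
    hc.1.comp_fst
  set Φ : ℝ × EuclideanSpace ℝ (Fin 3) → ℝ := fun z =>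
    π z.1 z.2 - (localPressureNear x₀ r v z.1 z.2 + localPressureFar x₀ r v z.1 z.2 + c z.1) with hΦ
  have hΦm : AEStronglyMeasurable Φ (μt.prod μB) := hπm.sub ((hNm.add hFam).add hcm)
  -- the measurable modification and its zero set
  have hE : MeasurableSet {z | hΦm.mk Φ z = 0} :=
    hΦm.stronglyMeasurable_mk.measurable (measurableSet_singleton 0)
  have h1 : Φ =ᵐ[μt.prod μB] hΦm.mk Φ := hΦm.ae_eq_mk
  have h2 : ∀ᵐ t ∂μt, ∀ᵐ x ∂μB, Φ (t, x) = hΦm.mk Φ (t, x) := Measure.ae_ae_of_ae_prod h1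
  have h3 : ∀ᵐ t ∂μt, ∀ᵐ x ∂μB, (t, x) ∈ {z | hΦm.mk Φ z = 0} := by
    filter_upwards [h2, hslice] with t ht hs
    filter_upwards [ht, hs] with x hx hsx
    show hΦm.mk Φ (t, x) = 0
    rw [← hx, hΦ]
    dsimp only
    rw [hsx]
    ring
  have h4 : ∀ᵐ z ∂μt.prod μB, z ∈ {z | hΦm.mk Φ z = 0} :=
    (Measure.ae_prod_mem_iff_ae_ae_mem hE).2 h3
  rw [← hprod]
  filter_upwards [h4, h1] with z hz hz1
  have hΦz : Φ z = 0 := by rw [hz1]; exact hz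
  rw [hΦ] at hΦz
  dsimp only at hΦz
  linarith

/-- **A measurable gauge for the pressure at a centre, slab class** (Kang–Miura–Tsai 2021,
Lemma 3.4, radius `3`, through `exists_pressure_decomposition`, modified on a null set of times
to be measurable): for a local Leray solution `(u, p)` on `(0,T) × ℝ³` and a centre `y` there is a
measurable `c : ℝ → ℝ` in `L^{3/2}(0,T)` with `p - c = p_loc + p_far` a.e. on `(0,T) × B_3(y)`
and `∫∫_{(0,T)×B_R} |p - c|^{3/2} < ∞` for every `R > 0`. (The slab twin of
`JiaSverak2013.exists_measurable_gauge`; this is the gauged pressure `p - c_{x₀}(t)` of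
Jia–Šverák 2014, Lemma 3.1.) [cite: KangMiuraTsai2020, Lemma 3.4 (the gauge c_{x₀,r}), arXiv:1812.10509 p. 8] [cite: JiaSverak2014, §3 Lemma 3.1 (the constant c_{x₀}(t))] -/
theorem exists_measurable_gauge {u₀ : (EuclideanSpace ℝ (Fin 3)) → (EuclideanSpace ℝ (Fin 3))}
    {u : ℝ → (EuclideanSpace ℝ (Fin 3)) → (EuclideanSpace ℝ (Fin 3))} {p : ℝ → (EuclideanSpace ℝ (Fin 3)) → ℝ}
    (hv : IsLocalLeraySolutionOn T ν u₀ u p) (y : (EuclideanSpace ℝ (Fin 3))) :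
    ∃ c : ℝ → ℝ, Measurable c ∧
      MemLp c (3 / 2 : ℝ≥0∞) (volume.restrict (Ioo 0 T)) ∧
      (∀ᵐ z ∂(volume.restrict (Ioo 0 T ×ˢ ball y 3)),
        p z.1 z.2 - c z.1 = localPressureNear y 3 u z.1 z.2 + localPressureFar y 3 u z.1 z.2) ∧
      ∀ R : ℝ, 0 < R →
        ∫⁻ z in Ioo 0 T ×ˢ ball (0 : (EuclideanSpace ℝ (Fin 3))) R, ‖p z.1 z.2 - c z.1‖ₑ ^ (3 / 2 : ℝ) < ⊤ := by
  obtain ⟨c₀, hc₀, hdec₀⟩ := hv.exists_pressure_decomposition y (by norm_num : (0 : ℝ) < 3)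
  -- a measurable modification on `(0, T)`
  have hae : AEMeasurable c₀ (volume.restrict (Ioo (0 : ℝ) T)) := hc₀.1.aemeasurable
  set c : ℝ → ℝ := hae.mk c₀ with hc
  have hcm : Measurable c := hae.measurable_mk
  have hcc : c₀ =ᵐ[volume.restrict (Ioo (0 : ℝ) T)] c := hae.ae_eq_mk
  have hmem : MemLp c (3 / 2 : ℝ≥0∞) (volume.restrict (Ioo 0 T)) := hc₀.ae_eq hcc
  have hbox : ∀ S : Set (EuclideanSpace ℝ (Fin 3)),
      (volume.restrict (Ioo 0 T)).prod (volume.restrict S) = volume.restrict (Ioo 0 T ×ˢ S) :=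
    fun S => by rw [Measure.prod_restrict, ← Measure.volume_eq_prod]
  have hdec : ∀ᵐ z ∂(volume.restrict (Ioo 0 T ×ˢ ball y 3)),
      p z.1 z.2 - c z.1 = localPressureNear y 3 u z.1 z.2 + localPressureFar y 3 u z.1 z.2 := by
    have hfst : (fun z : ℝ × (EuclideanSpace ℝ (Fin 3)) => c₀ z.1) =ᵐ[(volume.restrict (Ioo 0 T)).prod (volume.restrict (ball y 3))]
        fun z => c z.1 :=
      Measure.QuasiMeasurePreserving.ae_eq Measure.quasiMeasurePreserving_fst hcc
    rw [hbox] at hfst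
    filter_upwards [hdec₀, hfst] with z h1 h2
    rw [← h2, h1]
    ring
  refine ⟨c, hcm, hmem, hdec, fun R hR => ?_⟩
  -- finiteness on `(0,T) × B_R`
  set S : Set (ℝ × (EuclideanSpace ℝ (Fin 3))) := Ioo 0 T ×ˢ ball (0 : (EuclideanSpace ℝ (Fin 3))) R with hS
  have hπm : AEStronglyMeasurable (uncurry p) (volume.restrict S) :=
    hv.aestronglyMeasurable_pressure.mono_measure
      (Measure.restrict_mono (Set.prod_mono Subset.rfl (subset_univ _)) le_rfl)
  have hπS : AEMeasurable (fun z : ℝ × (EuclideanSpace ℝ (Fin 3)) => ‖p z.1 z.2‖ₑ ^ (3 / 2 : ℝ)) (volume.restrict S) :=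
    hπm.aemeasurable.enorm.pow_const _
  have hpt : ∀ z : ℝ × (EuclideanSpace ℝ (Fin 3)), ‖p z.1 z.2 - c z.1‖ₑ ^ (3 / 2 : ℝ) ≤
      (2 : ℝ≥0∞) ^ (1 / 2 : ℝ) * ‖p z.1 z.2‖ₑ ^ (3 / 2 : ℝ) +
        (2 : ℝ≥0∞) ^ (1 / 2 : ℝ) * ‖c z.1‖ₑ ^ (3 / 2 : ℝ) := fun z => by
    rw [← mul_add]; exact enorm_sub_rpow_threeHalves_le _ _
  have h1 : ∫⁻ z in S, ‖p z.1 z.2‖ₑ ^ (3 / 2 : ℝ) < ⊤ :=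
    (lintegral_mono_set (Set.prod_mono Subset.rfl ball_subset_closedBall)).trans_lt
      (hv.pressure _ (isCompact_closedBall _ _))
  have h2 : ∫⁻ z in S, ‖c z.1‖ₑ ^ (3 / 2 : ℝ) < ⊤ := by
    rw [hS, lintegral_prod_of_time_only (g := fun t => ‖c t‖ₑ ^ (3 / 2 : ℝ))
      (hcm.enorm.pow_const _) (Ioo 0 T) (ball (0 : (EuclideanSpace ℝ (Fin 3))) R)]
    refine ENNReal.mul_lt_top ?_ measure_ball_lt_top
    have hm := hmem.eLpNorm_lt_top
    rw [eLpNorm_lt_top_iff_lintegral_rpow_enorm_lt_top (by norm_num)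
      (ENNReal.div_ne_top (by norm_num) (by norm_num))] at hm
    have e : ((3 / 2 : ℝ≥0∞)).toReal = (3 / 2 : ℝ) := by
      rw [ENNReal.toReal_div]; norm_num
    rw [e] at hm
    exact hm
  have s2top : (2 : ℝ≥0∞) ^ (1 / 2 : ℝ) ≠ ⊤ := ENNReal.rpow_ne_top_of_nonneg (by norm_num) ENNReal.ofNat_ne_top
  calc ∫⁻ z in S, ‖p z.1 z.2 - c z.1‖ₑ ^ (3 / 2 : ℝ)
      ≤ ∫⁻ z in S, (2 : ℝ≥0∞) ^ (1 / 2 : ℝ) * ‖p z.1 z.2‖ₑ ^ (3 / 2 : ℝ) +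
          (2 : ℝ≥0∞) ^ (1 / 2 : ℝ) * ‖c z.1‖ₑ ^ (3 / 2 : ℝ) := lintegral_mono hpt
    _ = (2 : ℝ≥0∞) ^ (1 / 2 : ℝ) * (∫⁻ z in S, ‖p z.1 z.2‖ₑ ^ (3 / 2 : ℝ)) +
          (2 : ℝ≥0∞) ^ (1 / 2 : ℝ) * ∫⁻ z in S, ‖c z.1‖ₑ ^ (3 / 2 : ℝ) := by
        rw [lintegral_add_left' (hπS.const_mul _), lintegral_const_mul'' _ hπS,
          lintegral_const_mul' _ _ s2top]
    _ < ⊤ := ENNReal.add_lt_top.2 ⟨ENNReal.mul_lt_top (lt_top_iff_ne_top.2 s2top) h1,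
          ENNReal.mul_lt_top (lt_top_iff_ne_top.2 s2top) h2⟩

end IsLocalLeraySolutionOn

end Literature.Analysis.FluidPDE

end
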